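import Literature.MathematicalPhysics.QuantumLattice.GrassmannIntegralProofs
import Summits.QuantumFields.QCD.Theorems.SpectralDefectExtinctionWindowExtinctionProductFluxDefs
import HarnessLib

/-!
# Sector decomposition of `Γ₅ D_W` for the product-flux field — the spin/sector bookkeeping

Route SpectralDefectExtinction, crux `WindowExtinction`, line free-volume-heavy-witness (r6), stub S13
(`stub_sectorCharpoly`), helper file 1 of 3.

For Lüscher's flux-sector field at the tensor `(m₀₁, m₂₃) = (jL, j′L)` the `(k₁, k₃)`-block of the Hermitian
Wilson–Dirac operator `Γ₅ D_W` acts on functions of `(x₀, x₂)` with values in `ℂ⁴` (chiral spin basis of the tree,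
`euclideanGamma`, `Γ₅ = diag(1,1,−1,−1)`) as
`Γ₅ · [(m₀ + 4) − ĉ₀ + iγ₀ŝ₀ − ĉ₂ + iγ₂ŝ₂ − cos Φ₁ + iγ₁ sin Φ₁ − cos Φ₃ + iγ₃ sin Φ₃]`,
`Φ₁ = ringPhase L j k₁ x₀`, `Φ₃ = ringPhase L j′ k₃ x₂`.  This file records that matrix ENTRYWISE, in the
"hopping form" in which it falls out of `wilsonDirac` (`hopBlockEntry`), and proves that, after the permutation
`0 ↦ (B↓,A↑), 1 ↦ (B↑,A↓), 2 ↦ (B↓,A↓), 3 ↦ (B↑,A↑)` of the chiral spin index into the (swapped-`B`, `A`) sector labels (`toSectorIdx` / `sectorSpin`; this permutation is the spin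
rotation `γ ↦ (−σᶻ⊗σʸ, −σᶻ⊗σˣ, σʸ⊗1, σˣ⊗1)` followed by the swap of the two `B` components — it happens to be the
permutation matrix `CNOT`), it is entry-for-entry the vocabulary's `sectorH L j j′ k₁ k₃ m₀`
(`hopBlockEntry_eq_sectorH`).  Pure finite algebra: sixteen spin cases, each a ring identity.  The Fourier analysis in
`x₁, x₃` and the assembly of `charpoly (Γ₅ D_W) = ∏ charpoly (sectorH …)` are in the sibling files
`…StubSectorCharpolyFourier.lean`, `…StubSectorCharpoly.lean`.
-/

noncomputable section

namespace Summit.QuantumFields.QCD.Cruxes.WindowExtinction.FreeVolumeHeavyWitness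

open Matrix Complex
open scoped Kronecker
open Literature.MathematicalPhysics.QuantumLattice

/-! ### Small facts about the ring vocabulary -/

/-- The winding phase with both parameters negated is minus the phase, up to a full turn:
`Φ_{−j,−k}(x) = [k ≠ 0]·2π − Φ_{j,k}(x)`. -/
theorem ringPhase_neg_neg (L : ℕ) [NeZero L] (j : ℤ) (k x : ZMod L) :
    ringPhase L (-j) (-k) x = (if k = 0 then 0 else 2 * Real.pi) - ringPhase L j k x := by
  have hL : (L : ℝ) ≠ 0 := Nat.cast_ne_zero.mpr (NeZero.ne L)
  unfold ringPhase
  rw [ZMod.neg_val]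
  split_ifs with hk
  · subst hk
    simp only [ZMod.val_zero, Nat.cast_zero, Int.cast_neg]
    ring
  · rw [Nat.cast_sub (ZMod.val_lt k).le]
    push_cast
    field_simp
    ring

/-- `cos Φ_{−j,−k} = cos Φ_{j,k}` on the ring. -/
theorem cos_ringPhase_neg_neg : ∀ (L : ℕ) [NeZero L] (j : ℤ) (k x : ZMod L),
    Real.cos (ringPhase L (-j) (-k) x) = Real.cos (ringPhase L j k x) := by
  intro L _ j k x
  rw [ringPhase_neg_neg]
  split_ifs
  · rw [zero_sub, Real.cos_neg]
  · rw [Real.cos_two_pi_sub]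

/-- `sin Φ_{−j,−k} = −sin Φ_{j,k}` on the ring. -/
theorem sin_ringPhase_neg_neg (L : ℕ) [NeZero L] (j : ℤ) (k x : ZMod L) :
    Real.sin (ringPhase L (-j) (-k) x) = -Real.sin (ringPhase L j k x) := by
  rw [ringPhase_neg_neg]
  split_ifs
  · rw [zero_sub, Real.sin_neg]
  · rw [Real.sin_two_pi_sub]

/-- `𝔷ᴴ = ŝ − i·diag(sin Φ)`. -/
theorem ringZ_conjTranspose (L : ℕ) (j : ℤ) (k : ZMod L) :
    (ringZ L j k)ᴴ = ringSin L + Matrix.diagonal fun x => -(I * (Real.sin (ringPhase L j k x) : ℂ)) := by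
  rw [ringZ, conjTranspose_add, ringSin_conjTranspose, diagonal_conjTranspose]
  congr 1
  refine congrArg Matrix.diagonal (funext fun x => ?_)
  simp only [Pi.star_apply, star_mul', Complex.star_def, Complex.conj_I, Complex.conj_ofReal]
  ring

/-- `sectorH` with the three conjugate transposes written out. -/
theorem sectorH_expand (L : ℕ) (j j' : ℤ) (k₁ k₃ : ZMod L) (m : ℝ) :
    sectorH L j j' k₁ k₃ m =
      Matrix.fromBlocks
        (Matrix.fromBlocks ((m : ℂ) • (1 : Matrix (ZMod L) (ZMod L) ℂ) + ringW L (-j') (-k₃))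
              (ringSin L + Matrix.diagonal fun x => -(I * (Real.sin (ringPhase L (-j') (-k₃) x) : ℂ)))
              (ringZ L (-j') (-k₃)) (-((m : ℂ) • (1 : Matrix (ZMod L) (ZMod L) ℂ) + ringW L (-j') (-k₃))) ⊗ₖ
            (1 : Matrix (ZMod L) (ZMod L) ℂ) +
          Matrix.fromBlocks (1 : Matrix (ZMod L) (ZMod L) ℂ) 0 0 (-1) ⊗ₖ ringW L j k₁)
        ((1 : Matrix (ZMod L ⊕ ZMod L) (ZMod L ⊕ ZMod L) ℂ) ⊗ₖ
          (ringSin L + Matrix.diagonal fun x => -(I * (Real.sin (ringPhase L j k₁ x) : ℂ))))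
        ((1 : Matrix (ZMod L ⊕ ZMod L) (ZMod L ⊕ ZMod L) ℂ) ⊗ₖ ringZ L j k₁)
        (-(Matrix.fromBlocks ((m : ℂ) • (1 : Matrix (ZMod L) (ZMod L) ℂ) + ringW L (-j') (-k₃))
              (ringSin L + Matrix.diagonal fun x => -(I * (Real.sin (ringPhase L (-j') (-k₃) x) : ℂ)))
              (ringZ L (-j') (-k₃)) (-((m : ℂ) • (1 : Matrix (ZMod L) (ZMod L) ℂ) + ringW L (-j') (-k₃))) ⊗ₖ
            (1 : Matrix (ZMod L) (ZMod L) ℂ) +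
          Matrix.fromBlocks (1 : Matrix (ZMod L) (ZMod L) ℂ) 0 0 (-1) ⊗ₖ ringW L j k₁)) := by
  rw [sectorH, sectorK, sectorZ, ringDirac, conjTranspose_kronecker, conjTranspose_one, ringZ_conjTranspose,
    ringZ_conjTranspose]

/-! ### The sector index bookkeeping -/

/-- Index type of one sector block: `(B-component) ⊕`-blocks of `((A-component ⊕-blocks of x₂) × x₀)`. -/
abbrev SectorIdx (L : ℕ) : Type := ((ZMod L ⊕ ZMod L) × ZMod L) ⊕ ((ZMod L ⊕ ZMod L) × ZMod L)

/-- The chiral spin index (`Fin 4`, basis of `euclideanGamma`) carried by a sector basis vector. -/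
def sectorSpin {L : ℕ} : SectorIdx L → Fin 4
  | Sum.inl (Sum.inl _, _) => 0
  | Sum.inl (Sum.inr _, _) => 2
  | Sum.inr (Sum.inl _, _) => 3
  | Sum.inr (Sum.inr _, _) => 1

/-- The `x₀` coordinate (the `B`-plane variable) of a sector index. -/
def sectorPosB {L : ℕ} (ι : SectorIdx L) : ZMod L := (Sum.elim id id ι).2

/-- The `x₂` coordinate (the `A`-plane variable) of a sector index. -/
def sectorPosA {L : ℕ} (ι : SectorIdx L) : ZMod L := Sum.elim id id (Sum.elim id id ι).1

/-- The sector index with chiral spin `α` and coordinates `(x₂, x₀)`. -/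
def toSectorIdx {L : ℕ} (α : Fin 4) (x2 x0 : ZMod L) : SectorIdx L :=
  ![Sum.inl (Sum.inl x2, x0), Sum.inr (Sum.inr x2, x0), Sum.inl (Sum.inr x2, x0), Sum.inr (Sum.inl x2, x0)] α

/-- Spin of `(B↓, A↑)` vectors. -/
@[simp] theorem sectorSpin_ll {L : ℕ} (y2 y0 : ZMod L) : sectorSpin (Sum.inl (Sum.inl y2, y0)) = 0 := rfl
/-- Spin of `(B↓, A↓)` vectors. -/
@[simp] theorem sectorSpin_lr {L : ℕ} (y2 y0 : ZMod L) : sectorSpin (Sum.inl (Sum.inr y2, y0)) = 2 := rfl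
/-- Spin of `(B↑, A↑)` vectors. -/
@[simp] theorem sectorSpin_rl {L : ℕ} (y2 y0 : ZMod L) : sectorSpin (Sum.inr (Sum.inl y2, y0)) = 3 := rfl
/-- Spin of `(B↑, A↓)` vectors. -/
@[simp] theorem sectorSpin_rr {L : ℕ} (y2 y0 : ZMod L) : sectorSpin (Sum.inr (Sum.inr y2, y0)) = 1 := rfl
/-- `x₀` coordinate, case `ll`. -/
@[simp] theorem sectorPosB_ll {L : ℕ} (y2 y0 : ZMod L) : sectorPosB (Sum.inl (Sum.inl y2, y0)) = y0 := rfl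
/-- `x₀` coordinate, case `lr`. -/
@[simp] theorem sectorPosB_lr {L : ℕ} (y2 y0 : ZMod L) : sectorPosB (Sum.inl (Sum.inr y2, y0)) = y0 := rfl
/-- `x₀` coordinate, case `rl`. -/
@[simp] theorem sectorPosB_rl {L : ℕ} (y2 y0 : ZMod L) : sectorPosB (Sum.inr (Sum.inl y2, y0)) = y0 := rfl
/-- `x₀` coordinate, case `rr`. -/
@[simp] theorem sectorPosB_rr {L : ℕ} (y2 y0 : ZMod L) : sectorPosB (Sum.inr (Sum.inr y2, y0)) = y0 := rfl
/-- `x₂` coordinate, case `ll`. -/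
@[simp] theorem sectorPosA_ll {L : ℕ} (y2 y0 : ZMod L) : sectorPosA (Sum.inl (Sum.inl y2, y0)) = y2 := rfl
/-- `x₂` coordinate, case `lr`. -/
@[simp] theorem sectorPosA_lr {L : ℕ} (y2 y0 : ZMod L) : sectorPosA (Sum.inl (Sum.inr y2, y0)) = y2 := rfl
/-- `x₂` coordinate, case `rl`. -/
@[simp] theorem sectorPosA_rl {L : ℕ} (y2 y0 : ZMod L) : sectorPosA (Sum.inr (Sum.inl y2, y0)) = y2 := rfl
/-- `x₂` coordinate, case `rr`. -/
@[simp] theorem sectorPosA_rr {L : ℕ} (y2 y0 : ZMod L) : sectorPosA (Sum.inr (Sum.inr y2, y0)) = y2 := rfl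
/-- Sector index of chiral spin `0`. -/
@[simp] theorem toSectorIdx_zero {L : ℕ} (x2 x0 : ZMod L) : toSectorIdx 0 x2 x0 = Sum.inl (Sum.inl x2, x0) := rfl
/-- Sector index of chiral spin `1`. -/
@[simp] theorem toSectorIdx_one {L : ℕ} (x2 x0 : ZMod L) : toSectorIdx 1 x2 x0 = Sum.inr (Sum.inr x2, x0) := rfl
/-- Sector index of chiral spin `2`. -/
@[simp] theorem toSectorIdx_two {L : ℕ} (x2 x0 : ZMod L) : toSectorIdx 2 x2 x0 = Sum.inl (Sum.inr x2, x0) := rfl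
/-- Sector index of chiral spin `3`. -/
@[simp] theorem toSectorIdx_three {L : ℕ} (x2 x0 : ZMod L) : toSectorIdx 3 x2 x0 = Sum.inr (Sum.inl x2, x0) := rfl

/-- `toSectorIdx` inverts the coordinate maps. -/
theorem toSectorIdx_sectorSpin {L : ℕ} (ι : SectorIdx L) :
    toSectorIdx (sectorSpin ι) (sectorPosA ι) (sectorPosB ι) = ι := by
  rcases ι with ⟨(y2 | y2), y0⟩ | ⟨(y2 | y2), y0⟩ <;> rfl

/-- `sectorSpin ∘ toSectorIdx = id` on the spin. -/
@[simp] theorem sectorSpin_toSectorIdx {L : ℕ} (α : Fin 4) (x2 x0 : ZMod L) :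
    sectorSpin (toSectorIdx α x2 x0) = α := by
  fin_cases α <;> rfl

/-- `sectorPosA` of `toSectorIdx`. -/
@[simp] theorem sectorPosA_toSectorIdx {L : ℕ} (α : Fin 4) (x2 x0 : ZMod L) :
    sectorPosA (toSectorIdx α x2 x0) = x2 := by
  fin_cases α <;> rfl

/-- `sectorPosB` of `toSectorIdx`. -/
@[simp] theorem sectorPosB_toSectorIdx {L : ℕ} (α : Fin 4) (x2 x0 : ZMod L) :
    sectorPosB (toSectorIdx α x2 x0) = x0 := by
  fin_cases α <;> rfl

/-- A sector index is determined by its spin and its two coordinates. -/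
theorem sectorIdx_eq_iff {L : ℕ} (ι ι' : SectorIdx L) :
    ι = ι' ↔ sectorSpin ι = sectorSpin ι' ∧ sectorPosA ι = sectorPosA ι' ∧ sectorPosB ι = sectorPosB ι' := by
  constructor
  · rintro rfl; exact ⟨rfl, rfl, rfl⟩
  · rintro ⟨h1, h2, h3⟩
    rw [← toSectorIdx_sectorSpin ι, ← toSectorIdx_sectorSpin ι', h1, h2, h3]

/-! ### The chiral-basis sector block, entrywise (hopping form) -/

/-- The diagonal of `Γ₅ = diag(1, 1, −1, −1)` (chiral basis). -/
def chiralSign : Fin 4 → ℂ := ![1, 1, -1, -1]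

/-- Forward hop indicator on the ring: `[x + 1 = y]`. -/
def hopFwd {L : ℕ} (x y : ZMod L) : ℂ := if x + 1 = y then 1 else 0

/-- Backward hop indicator on the ring: `[x − 1 = y]`. -/
def hopBwd {L : ℕ} (x y : ZMod L) : ℂ := if x - 1 = y then 1 else 0

/-- `hop⁺` in the orientation of `ringCos`/`ringSin`. -/
theorem hopFwd_eq {L : ℕ} (x y : ZMod L) : hopFwd x y = if y = x + 1 then 1 else 0 := by
  unfold hopFwd
  congr 1
  exact propext eq_comm

/-- `hop⁻` in the orientation of `ringCos`/`ringSin`. -/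
theorem hopBwd_eq {L : ℕ} (x y : ZMod L) : hopBwd x y = if x = y + 1 then 1 else 0 := by
  unfold hopBwd
  congr 1
  exact propext ⟨fun h => by rw [← h]; ring, fun h => by rw [h]; ring⟩

/-- `ĉ = (hop⁺ + hop⁻)/2`. -/
theorem ringCos_eq_hop {L : ℕ} (x y : ZMod L) : ringCos L x y = (hopFwd x y + hopBwd x y) / 2 := by
  rw [hopFwd_eq, hopBwd_eq]
  rfl

/-- `ŝ = −(i/2)(hop⁺ − hop⁻)`. -/
theorem ringSin_eq_hop {L : ℕ} (x y : ZMod L) : ringSin L x y = -(I / 2) * (hopFwd x y - hopBwd x y) := by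
  rw [hopFwd_eq, hopBwd_eq]
  simp only [ringSin, Matrix.of_apply]
  have hI : (2 : ℂ) * I ≠ 0 := mul_ne_zero two_ne_zero Complex.I_ne_zero
  field_simp
  ring_nf
  rw [Complex.I_sq]
  ring

/-- Entry `((α, x₀, x₂), ι)` of the `(k₁,k₃)`-block of `Γ₅ D_W(V_[(jL, j′L)], m₀, 1)` in the chiral basis, in the
form in which it falls out of the tree's `wilsonDirac` (mass term and, for each direction, the forward hop
`−½(1 − γ_μ)U` and the backward hop `−½(1 + γ_μ)U⁻¹`, the `x₁, x₃` plane waves already contracted into the phases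
`e^{±iΦ₁}`, `e^{±iΦ₃}`). -/
def hopBlockEntry (L : ℕ) (j j' : ℤ) (k₁ k₃ : ZMod L) (m₀ : ℝ) (α : Fin 4) (x0 x2 : ZMod L)
    (ι : SectorIdx L) : ℂ :=
  chiralSign α *
    (((m₀ : ℂ) + 4) * ((if x0 = sectorPosB ι then 1 else 0) * (if x2 = sectorPosA ι then 1 else 0)) *
        (1 : Matrix (Fin 4) (Fin 4) ℂ) α (sectorSpin ι) -
      1 / 2 *
        ((1 - euclideanGamma 0) α (sectorSpin ι) *
            (hopFwd x0 (sectorPosB ι) * (if x2 = sectorPosA ι then 1 else 0)) +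
          (1 + euclideanGamma 0) α (sectorSpin ι) *
            (hopBwd x0 (sectorPosB ι) * (if x2 = sectorPosA ι then 1 else 0)) +
          (1 - euclideanGamma 1) α (sectorSpin ι) *
            ((Real.cos (ringPhase L j k₁ x0) : ℂ) + (Real.sin (ringPhase L j k₁ x0) : ℂ) * I) *
            ((if x0 = sectorPosB ι then 1 else 0) * (if x2 = sectorPosA ι then 1 else 0)) +
          (1 + euclideanGamma 1) α (sectorSpin ι) *
            ((Real.cos (ringPhase L j k₁ x0) : ℂ) - (Real.sin (ringPhase L j k₁ x0) : ℂ) * I) *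
            ((if x0 = sectorPosB ι then 1 else 0) * (if x2 = sectorPosA ι then 1 else 0)) +
          (1 - euclideanGamma 2) α (sectorSpin ι) *
            ((if x0 = sectorPosB ι then 1 else 0) * hopFwd x2 (sectorPosA ι)) +
          (1 + euclideanGamma 2) α (sectorSpin ι) *
            ((if x0 = sectorPosB ι then 1 else 0) * hopBwd x2 (sectorPosA ι)) +
          (1 - euclideanGamma 3) α (sectorSpin ι) *
            ((Real.cos (ringPhase L j' k₃ x2) : ℂ) + (Real.sin (ringPhase L j' k₃ x2) : ℂ) * I) *
            ((if x0 = sectorPosB ι then 1 else 0) * (if x2 = sectorPosA ι then 1 else 0)) +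
          (1 + euclideanGamma 3) α (sectorSpin ι) *
            ((Real.cos (ringPhase L j' k₃ x2) : ℂ) - (Real.sin (ringPhase L j' k₃ x2) : ℂ) * I) *
            ((if x0 = sectorPosB ι then 1 else 0) * (if x2 = sectorPosA ι then 1 else 0))))

/-- **The sector block (hopping form) is `sectorH`.** -/
theorem hopBlockEntry_eq_sectorH (L : ℕ) [NeZero L] (j j' : ℤ) (k₁ k₃ : ZMod L) (m₀ : ℝ) (α : Fin 4)
    (x0 x2 : ZMod L) (ι : SectorIdx L) :
    hopBlockEntry L j j' k₁ k₃ m₀ α x0 x2 ι = sectorH L j j' k₁ k₃ m₀ (toSectorIdx α x2 x0) ι := by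
  rw [sectorH_expand]
  rcases ι with ⟨(y2 | y2), y0⟩ | ⟨(y2 | y2), y0⟩ <;> fin_cases α <;>
    by_cases h0 : x0 = y0 <;> by_cases h2 : x2 = y2 <;>
    simp [h0, h2, hopBlockEntry, chiralSign, ringW, ringZ, ringCos_eq_hop, ringSin_eq_hop,
      Matrix.fromBlocks_apply₁₁, Matrix.fromBlocks_apply₁₂, Matrix.fromBlocks_apply₂₁, Matrix.fromBlocks_apply₂₂,
      Matrix.kroneckerMap_apply, Matrix.one_apply, Matrix.smul_apply,
      euclideanGamma_zero, euclideanGamma_one, euclideanGamma_two, euclideanGamma_three,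
      cos_ringPhase_neg_neg, sin_ringPhase_neg_neg] <;>
    ring_nf

end Summit.QuantumFields.QCD.Cruxes.WindowExtinction.FreeVolumeHeavyWitness

end
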